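import Mathlib
import Summits.Ventures.PercRepro2.Defs
import Summits.Ventures.PercRepro2.Harris
import Summits.Ventures.PercRepro2.Graph
import Summits.Ventures.PercRepro2.Events
import Summits.Ventures.PercRepro2.Induced
import Summits.Ventures.PercRepro2.CDAvoidAnti
import Summits.Ventures.PercRepro2.XorHalf

/-!
# The (CR) form and its reduction to the XOR form (blind cell PercRepro2, mine-a g38;
MINE-A.md §93.9–§93.11)

Root `s`, a finite set `X`, `R = {s ↮ X}`, up-set events `U = {C_s ∈ 𝓤}`, `e = {C_s ∈ 𝓥}` of the
cluster of `s`, `π = P(R)`.  The candidate (CR) of MINE-A.md §93.9 is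

  `P(Rᶜ U e) + P(R U) · P(e ∣ R) ≥ P(U) · P(e)`,   i.e.   `Cov(U, e) ≥ P(R) · Cov(U, e ∣ R)`

(Harris with the avoiding world's share of `P(U e)` replaced by its BHK lower bound); multiplied by
`π` it is `crForm := π P(Rᶜ U e) + P(R U) P(R e) − π P(U) P(e) ≥ 0`.  THIS FILE: the exact identity

  `π · XOR = π · crForm + (1 − π)(π P(RUe) − P(RU) P(Re)) + (π P(U) − P(RU)) (π P(e) − P(Re))`

(`xor_cr_identity`), whence `XOR ≥ crForm` (`xorForm_ge_crForm`; BHK under `R` and the monotone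
conditioning make the two extra terms nonnegative) and `(CR) ⟹ (XOR)` (`xorForm_nonneg_of_cr`).
(CR) itself is a candidate (exhaustive at `p = 1/2` on every graph on ≤ 5 vertices, 433,097,280
tests, 0 violations; weight adversaries 0 negatives — MINE-A.md §93.11); nothing about it is claimed
here beyond the reduction.  No definition; one seat.
-/

namespace Summit.Ventures.PercRepro2

namespace CRForms

variable {V : Type*} {E : Type*} [Fintype V] [DecidableEq V] [Fintype E] [DecidableEq E]
  {R : Type*} [Field R] [LinearOrder R] [IsStrictOrderedRing R]

omit [Fintype V] [DecidableEq V] in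
/-- **The identity** `π · XOR = π · crForm + (1 − π)(π a − b d) + (π u − b)(π ε − d)` with
`π = P(R)`, `a = P(RUe)`, `b = P(RU)`, `d = P(Re)`, `u = P(U)`, `ε = P(e)`,
`crForm = π P(Rᶜ U e) + b d − π u ε`. -/
theorem xor_cr_identity (p : E → R) (ends : E → Sym2 V) (s : V) (X : Finset V)
    (𝓤 𝓥 : Set (Set V)) :
    let Rv := avoidAll ends s X
    let U := clusterInEvent ends s 𝓤
    let e := clusterInEvent ends s 𝓥
    prob p Rv * (prob p (Rv ∩ U ∩ e) * prob p Rvᶜ + prob p (Rvᶜ ∩ U ∩ e) * prob p Rv -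
        prob p (Rv ∩ U) * prob p (Rvᶜ ∩ e) - prob p (Rvᶜ ∩ U) * prob p (Rv ∩ e)) =
      prob p Rv * (prob p Rv * prob p (Rvᶜ ∩ U ∩ e) + prob p (Rv ∩ U) * prob p (Rv ∩ e) -
          prob p Rv * prob p U * prob p e) +
        (1 - prob p Rv) * (prob p Rv * prob p (Rv ∩ U ∩ e) - prob p (Rv ∩ U) * prob p (Rv ∩ e)) +
        (prob p Rv * prob p U - prob p (Rv ∩ U)) * (prob p Rv * prob p e - prob p (Rv ∩ e)) := by
  intro Rv U e
  have h := XorHalf.xorForm_eq p ends s X 𝓤 𝓥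
  simp only at h
  have hUe : prob p (Rvᶜ ∩ U ∩ e) = prob p (U ∩ e) - prob p (Rv ∩ U ∩ e) := by
    rw [Set.inter_assoc, XorHalf.prob_compl_inter, Set.inter_assoc]
  rw [h, hUe]
  ring

/-- `XOR ≥ crForm`: the XOR form dominates the (CR) form (BHK under `R` and the monotone
conditioning), for admissible weights and up-sets. -/
theorem xorForm_ge_crForm (p : E → R) (hp : IsProbVec p) (ends : E → Sym2 V) (s : V)
    (X : Finset V) {𝓤 𝓥 : Set (Set V)} (h𝓤 : IsUpperSet 𝓤) (h𝓥 : IsUpperSet 𝓥) :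
    let Rv := avoidAll ends s X
    let U := clusterInEvent ends s 𝓤
    let e := clusterInEvent ends s 𝓥
    prob p Rv * prob p (Rvᶜ ∩ U ∩ e) + prob p (Rv ∩ U) * prob p (Rv ∩ e) -
        prob p Rv * prob p U * prob p e ≤
      prob p (Rv ∩ U ∩ e) * prob p Rvᶜ + prob p (Rvᶜ ∩ U ∩ e) * prob p Rv -
        prob p (Rv ∩ U) * prob p (Rvᶜ ∩ e) - prob p (Rvᶜ ∩ U) * prob p (Rv ∩ e) := by
  intro Rv U e
  have hRv : Rv = avoidAll ends s X := rfl
  have hU : U = clusterInEvent ends s 𝓤 := rfl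
  have he : e = clusterInEvent ends s 𝓥 := rfl
  have hRlow : IsLowerSet Rv := XorHalf.isLowerSet_avoidAll ends s X
  have hUup : IsUpperSet U := isUpperSet_clusterInEvent ends s h𝓤
  have heup : IsUpperSet e := isUpperSet_clusterInEvent ends s h𝓥
  have hbhk : prob p (Rv ∩ U) * prob p (Rv ∩ e) ≤ prob p Rv * prob p (Rv ∩ U ∩ e) := by
    have := CDAvoidAnti.bhk_same_cluster_avoid p ends hp s X h𝓤 h𝓥
    rw [← hRv, ← hU, ← he] at this
    have e1 : U ∩ Rv = Rv ∩ U := Set.inter_comm _ _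
    have e2 : e ∩ Rv = Rv ∩ e := Set.inter_comm _ _
    have e3 : U ∩ e ∩ Rv = Rv ∩ U ∩ e := by ext ω; simp only [Set.mem_inter_iff]; tauto
    rw [e1, e2, e3] at this
    linarith
  have hbU : prob p (Rv ∩ U) ≤ prob p Rv * prob p U :=
    prob_inter_le_prob_mul_prob_of_isLowerSet hp hRlow hUup
  have hde : prob p (Rv ∩ e) ≤ prob p Rv * prob p e :=
    prob_inter_le_prob_mul_prob_of_isLowerSet hp hRlow heup
  have hπ0 : 0 ≤ prob p Rv := prob_nonneg hp Rv
  have hπ1 : prob p Rv ≤ 1 := prob_le_one hp Rv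
  have hid := xor_cr_identity p ends s X 𝓤 𝓥
  simp only at hid
  rw [← hRv, ← hU, ← he] at hid
  have h1 : 0 ≤ (1 - prob p Rv) * (prob p Rv * prob p (Rv ∩ U ∩ e) - prob p (Rv ∩ U) * prob p (Rv ∩ e)) :=
    mul_nonneg (by linarith) (by linarith)
  have h2 : 0 ≤ (prob p Rv * prob p U - prob p (Rv ∩ U)) * (prob p Rv * prob p e - prob p (Rv ∩ e)) :=
    mul_nonneg (by linarith) (by linarith)
  rcases hπ0.lt_or_eq with hpos | hzero
  · have : prob p Rv * (prob p (Rv ∩ U ∩ e) * prob p Rvᶜ + prob p (Rvᶜ ∩ U ∩ e) * prob p Rv -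
        prob p (Rv ∩ U) * prob p (Rvᶜ ∩ e) - prob p (Rvᶜ ∩ U) * prob p (Rv ∩ e)) -
        prob p Rv * (prob p Rv * prob p (Rvᶜ ∩ U ∩ e) + prob p (Rv ∩ U) * prob p (Rv ∩ e) -
          prob p Rv * prob p U * prob p e) ≥ 0 := by rw [hid]; linarith
    have hdiff := (mul_nonneg_iff_of_pos_left hpos).mp (by linarith [this] :
      0 ≤ prob p Rv * ((prob p (Rv ∩ U ∩ e) * prob p Rvᶜ + prob p (Rvᶜ ∩ U ∩ e) * prob p Rv -
        prob p (Rv ∩ U) * prob p (Rvᶜ ∩ e) - prob p (Rvᶜ ∩ U) * prob p (Rv ∩ e)) -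
        (prob p Rv * prob p (Rvᶜ ∩ U ∩ e) + prob p (Rv ∩ U) * prob p (Rv ∩ e) -
          prob p Rv * prob p U * prob p e)))
    linarith
  · -- `R` null: both sides vanish
    have hb0 : prob p (Rv ∩ U) = 0 :=
      le_antisymm (by linarith [prob_inter_le_left hp Rv U]) (prob_nonneg hp _)
    have hd0 : prob p (Rv ∩ e) = 0 :=
      le_antisymm (by linarith [prob_inter_le_left hp Rv e]) (prob_nonneg hp _)
    have ha0 : prob p (Rv ∩ U ∩ e) = 0 :=
      le_antisymm (by linarith [prob_inter_le_left hp (Rv ∩ U) e]) (prob_nonneg hp _)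
    rw [hb0, hd0, ha0, ← hzero]
    ring_nf
    exact le_refl 0

/-- **(CR) ⟹ (XOR)**: if the (CR) form is nonnegative then so is the XOR form. -/
theorem xorForm_nonneg_of_cr (p : E → R) (hp : IsProbVec p) (ends : E → Sym2 V) (s : V)
    (X : Finset V) {𝓤 𝓥 : Set (Set V)} (h𝓤 : IsUpperSet 𝓤) (h𝓥 : IsUpperSet 𝓥)
    (hcr : let Rv := avoidAll ends s X
      let U := clusterInEvent ends s 𝓤
      let e := clusterInEvent ends s 𝓥
      0 ≤ prob p Rv * prob p (Rvᶜ ∩ U ∩ e) + prob p (Rv ∩ U) * prob p (Rv ∩ e) -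
        prob p Rv * prob p U * prob p e) :
    let Rv := avoidAll ends s X
    let U := clusterInEvent ends s 𝓤
    let e := clusterInEvent ends s 𝓥
    0 ≤ prob p (Rv ∩ U ∩ e) * prob p Rvᶜ + prob p (Rvᶜ ∩ U ∩ e) * prob p Rv -
        prob p (Rv ∩ U) * prob p (Rvᶜ ∩ e) - prob p (Rvᶜ ∩ U) * prob p (Rv ∩ e) := by
  intro Rv U e
  have h := xorForm_ge_crForm p hp ends s X h𝓤 h𝓥
  simp only at h hcr
  linarith

end CRForms

end Summit.Ventures.PercRepro2
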